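import Summits.NavierStokesRegularity.NavierStokesRegularity.Theorems.TypeIQuarterGateQuarterLawTypeIUniformLocalTypeI
import Summits.NavierStokesRegularity.NavierStokesRegularity.Theorems.TypeIQuarterGateQuarterLawTypeIStubCountQuarterLaw
import Summits.NavierStokesRegularity.NavierStokesRegularity.Theorems.TypeIQuarterGateQuarterLawTypeIIffUniformCount
import Literature.Analysis.FluidPDE.EnstrophyGronwall
import HarnessLib

/-!
# Linear packing of loud cells under the Type-I rate, and the CLUSTER LAW form of
# `TypeIQuarterGate.QuarterLawTypeI` (crux stmt-NavierStokesRegularity-23726)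

Helper file (`--supports stmt-NavierStokesRegularity-23726`, def-free). Write
`F(s,y) = |∇u(s,y)|_F²` and call a centre `x` **`η`-loud at scale `r`** when the vertex-`T` cylinder
`(T − r², T) × B(x, r)` carries `∫∫ F ≥ η r` (the cells counted by `UniformConcentrationCountTypeI`,
stmt-23970).

1. `card_le_of_localDissipation` — LINEAR PACKING (pure bookkeeping): if the local dissipation obeys the
   Morrey-type bound `∫_{T−R²}^{T} ∫_{B(x,R)} ‖∇u‖² ≤ M R` for `0 < R ≤ r₀`, `R² ≤ T`, then a `2r`-separated
   family of `η`-loud centres lying in a ball `‖x − x₀‖ ≤ A r` has at most `3 M (A+1)/η` members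
   (`(A+1) r ≤ r₀`): loud cells pack at most ONE-DIMENSIONALLY (volume would allow `≍ A³`).
   `card_le_of_localDissipation_cover`: the same under a cover by `k` such balls (`≤ k · 3M(A+1)/η`).
2. `linearPacking_of_isTypeIBlowup` — along a classical Leray–Hopf solution from a rapidly decaying datum
   with the sup-norm Type-I rate the hypothesis of 1 holds (tree: `uniformLocalTypeI_of_isTypeIBlowup`,
   Seregin 2014 Prop. 3.11 / Albritton–Barker Lemma 2.6), so loud cells are linearly packed at every
   small scale.
3. CLUSTER LAW. `uniformCount_of_clustered` / `quarterLaw_of_clustered`: if for every `η` the `η`-loud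
   centres at scale `r` are covered by `k(η)` balls of radius `A(η)·r`, uniformly in `r ≤ r₁(η)`, then the
   scale-uniform count and hence (landed `stub_countQuarterLaw`) the quarter law `∫‖curl u(t)‖² ≤ K/√(T−t)`
   hold for that solution; `net_of_separated_card_le` / `clustered_of_count` give the combinatorial
   converse at one scale (counted ⟹ covered by `N` balls of radius `2r`). The converse along a solution,
   the by-name forms (K1 stmt-23726 ⟺ 24108 ⟺ 23970 ⟺ cluster law) and the violator's shape are in the
   companion file `TypeIQuarterGateQuarterLawTypeIClusterLaw`.

HONEST FRAMING: reformulations and a priori structure along ONE hypothetical Type-I blow-up; K1, 24108,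
23970 and NS regularity remain OPEN and nothing about the summit is claimed. [folklore]
[cite: Seregin2014, Ch. 6 §6.3 Prop. 3.11 (i)] [cite: CaffarelliKohnNirenberg1982, §6]
-/

-- the summit-side namespace repeats a component by design (D-0017)
set_option linter.dupNamespace false

noncomputable section

namespace Summit.NavierStokesRegularity.NavierStokesRegularity.Theorems

namespace QuarterLawLinearPacking

open Set MeasureTheory Function Metric Filter Topology
open scoped ENNReal NNReal
open Literature.Analysis.FluidPDE
/-! ### 1. Linear packing from a local dissipation bound -/

/-- **Linear packing of loud cells (one ball).** Under the local dissipation bound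
`∫_{T−R²}^{T}∫_{B(x,R)} ‖∇u‖ₑ² ≤ M R` (`0 < R ≤ r₀`, `R² ≤ T`), a `2r`-separated family of centres in the
ball `‖x − x₀‖ ≤ A r` whose vertex-`T` cylinders at scale `r` carry `∫∫ |∇u|_F² ≥ η r` has at most
`3 M (A+1)/η` members, provided `(A+1) r ≤ r₀` and `((A+1) r)² ≤ T`. [folklore] -/
theorem card_le_of_localDissipation
    {u : ℝ → EuclideanSpace ℝ (Fin 3) → EuclideanSpace ℝ (Fin 3)} {T M r₀ : ℝ} (hM : 0 ≤ M)
    (hE : ∀ (x : EuclideanSpace ℝ (Fin 3)), ∀ R ∈ Ioc 0 r₀, R ^ 2 ≤ T →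
      ∫⁻ t in Ioo (T - R ^ 2) T, ∫⁻ y in ball x R, ‖fderiv ℝ (u t) y‖ₑ ^ 2 ≤ ENNReal.ofReal (M * R))
    {η : ℝ} (hη : 0 < η) {r A : ℝ} (hr : 0 < r) (hA : 0 ≤ A) (hRr₀ : (A + 1) * r ≤ r₀)
    (hRT : ((A + 1) * r) ^ 2 ≤ T) (x₀ : EuclideanSpace ℝ (Fin 3))
    (σ : Finset (EuclideanSpace ℝ (Fin 3))) (hσ : ∀ x ∈ σ, ‖x - x₀‖ ≤ A * r)
    (hsep : ∀ x ∈ σ, ∀ x' ∈ σ, x ≠ x' → 2 * r ≤ ‖x - x'‖)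
    (hconc : ∀ x ∈ σ, ENNReal.ofReal (η * r) ≤ ∫⁻ s in Ioo (T - r ^ 2) T, ∫⁻ y in ball x r,
      ENNReal.ofReal (frobeniusNormSq (fderiv ℝ (u s) y))) :
    (σ.card : ℝ) ≤ 3 * M * (A + 1) / η := by
  classical
  set R : ℝ := (A + 1) * r with hR
  have hA1 : 1 ≤ A + 1 := by linarith
  have hRpos : 0 < R := by positivity
  have hrR : r ≤ R := by
    have : 1 * r ≤ (A + 1) * r := mul_le_mul_of_nonneg_right hA1 hr.le
    rwa [one_mul] at this
  -- the balls `B_r(x)`, `x ∈ σ`, are pairwise disjoint and lie in `B_R(x₀)`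
  have hdisj : Set.PairwiseDisjoint (↑σ : Set (EuclideanSpace ℝ (Fin 3))) (fun x => ball x r) := by
    intro x hx x' hx' hne
    have h2 : 2 * r ≤ dist x x' := by rw [dist_eq_norm]; exact hsep x hx x' hx' hne
    exact ball_disjoint_ball (by linarith)
  have hsub : (⋃ x ∈ σ, ball x r) ⊆ ball x₀ R := by
    intro y hy
    simp only [mem_iUnion, mem_ball, exists_prop] at hy
    obtain ⟨x, hx, hyx⟩ := hy
    rw [mem_ball]
    calc dist y x₀ ≤ dist y x + dist x x₀ := dist_triangle _ _ _
      _ < r + A * r := by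
          have := hσ x hx
          rw [← dist_eq_norm] at this
          linarith
      _ = R := by rw [hR]; ring
  -- the physical dissipation density
  set F : ℝ → EuclideanSpace ℝ (Fin 3) → ℝ≥0∞ := fun s y =>
    ENNReal.ofReal (frobeniusNormSq (fderiv ℝ (u s) y)) with hF
  -- lower bound
  have hlow : (σ.card : ℝ≥0∞) * ENNReal.ofReal (η * r) ≤
      ∑ x ∈ σ, ∫⁻ s in Ioo (T - r ^ 2) T, ∫⁻ y in ball x r, F s y := by
    rw [← nsmul_eq_mul, ← Finset.sum_const]
    exact Finset.sum_le_sum fun x hx => hconc x hx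
  -- upper bound: superadditivity, disjoint union inside the big ball, longer window, `|·|_F² ≤ 3‖·‖²`
  have hwin : Ioo (T - r ^ 2) T ⊆ Ioo (T - R ^ 2) T := by
    refine Ioo_subset_Ioo ?_ le_rfl
    have : r ^ 2 ≤ R ^ 2 := pow_le_pow_left₀ hr.le hrR 2
    linarith
  have hup : ∑ x ∈ σ, ∫⁻ s in Ioo (T - r ^ 2) T, ∫⁻ y in ball x r, F s y ≤
      ENNReal.ofReal (3 * M * R) := by
    refine (CountQuarterLaw.sum_lintegral_le _ σ _).trans ?_
    have h1 : ∫⁻ s in Ioo (T - r ^ 2) T, ∑ x ∈ σ, ∫⁻ y in ball x r, F s y ≤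
        ∫⁻ s in Ioo (T - r ^ 2) T, ∫⁻ y in ball x₀ R, F s y := by
      refine lintegral_mono fun s => ?_
      rw [← lintegral_biUnion_finset hdisj (fun x _ => measurableSet_ball)]
      exact lintegral_mono_set hsub
    have h2 : ∫⁻ s in Ioo (T - r ^ 2) T, ∫⁻ y in ball x₀ R, F s y ≤
        ∫⁻ s in Ioo (T - R ^ 2) T, ∫⁻ y in ball x₀ R, F s y := lintegral_mono_set hwin
    have h3 : ∫⁻ s in Ioo (T - R ^ 2) T, ∫⁻ y in ball x₀ R, F s y ≤
        ∫⁻ s in Ioo (T - R ^ 2) T, ∫⁻ y in ball x₀ R, 3 * ‖fderiv ℝ (u s) y‖ₑ ^ 2 :=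
      lintegral_mono fun s => lintegral_mono fun y => ofReal_frobeniusNormSq_le_three_mul_enorm_sq _
    have h4 : ∫⁻ s in Ioo (T - R ^ 2) T, ∫⁻ y in ball x₀ R, 3 * ‖fderiv ℝ (u s) y‖ₑ ^ 2 =
        3 * ∫⁻ s in Ioo (T - R ^ 2) T, ∫⁻ y in ball x₀ R, ‖fderiv ℝ (u s) y‖ₑ ^ 2 := by
      rw [← lintegral_const_mul' _ _ (by norm_num)]
      refine lintegral_congr fun s => ?_
      rw [lintegral_const_mul' _ _ (by norm_num)]
    have h5 : 3 * ∫⁻ s in Ioo (T - R ^ 2) T, ∫⁻ y in ball x₀ R, ‖fderiv ℝ (u s) y‖ₑ ^ 2 ≤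
        3 * ENNReal.ofReal (M * R) := by
      gcongr
      exact hE x₀ R ⟨hRpos, hRr₀⟩ hRT
    calc _ ≤ _ := h1
      _ ≤ _ := h2
      _ ≤ _ := h3
      _ = _ := h4
      _ ≤ _ := h5
      _ = ENNReal.ofReal (3 * M * R) := by
          rw [show (3 : ℝ≥0∞) = ENNReal.ofReal 3 by norm_num, ← ENNReal.ofReal_mul (by norm_num)]
          ring_nf
  -- combine in `ℝ`
  have hle : (σ.card : ℝ≥0∞) * ENNReal.ofReal (η * r) ≤ ENNReal.ofReal (3 * M * R) := hlow.trans hup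
  rw [← ENNReal.ofReal_natCast, ← ENNReal.ofReal_mul (Nat.cast_nonneg _),
    ENNReal.ofReal_le_ofReal_iff (by positivity)] at hle
  rw [le_div_iff₀ hη]
  have : (σ.card : ℝ) * η * r ≤ 3 * M * (A + 1) * r := by rw [hR] at hle; nlinarith [hle]
  nlinarith [this, hr]

/-- **Linear packing under a cover by `k` balls.** As `card_le_of_localDissipation`, for a `2r`-separated
loud family covered by the balls `‖x − x₀‖ ≤ A r`, `x₀ ∈ c`: at most `#c · 3M(A+1)/η` members.
[folklore] -/
theorem card_le_of_localDissipation_cover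
    {u : ℝ → EuclideanSpace ℝ (Fin 3) → EuclideanSpace ℝ (Fin 3)} {T M r₀ : ℝ} (hM : 0 ≤ M)
    (hE : ∀ (x : EuclideanSpace ℝ (Fin 3)), ∀ R ∈ Ioc 0 r₀, R ^ 2 ≤ T →
      ∫⁻ t in Ioo (T - R ^ 2) T, ∫⁻ y in ball x R, ‖fderiv ℝ (u t) y‖ₑ ^ 2 ≤ ENNReal.ofReal (M * R))
    {η : ℝ} (hη : 0 < η) {r A : ℝ} (hr : 0 < r) (hA : 0 ≤ A) (hRr₀ : (A + 1) * r ≤ r₀)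
    (hRT : ((A + 1) * r) ^ 2 ≤ T) (c : Finset (EuclideanSpace ℝ (Fin 3)))
    (σ : Finset (EuclideanSpace ℝ (Fin 3))) (hcov : ∀ x ∈ σ, ∃ x₀ ∈ c, ‖x - x₀‖ ≤ A * r)
    (hsep : ∀ x ∈ σ, ∀ x' ∈ σ, x ≠ x' → 2 * r ≤ ‖x - x'‖)
    (hconc : ∀ x ∈ σ, ENNReal.ofReal (η * r) ≤ ∫⁻ s in Ioo (T - r ^ 2) T, ∫⁻ y in ball x r,
      ENNReal.ofReal (frobeniusNormSq (fderiv ℝ (u s) y))) :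
    (σ.card : ℝ) ≤ c.card * (3 * M * (A + 1) / η) := by
  classical
  -- split `σ` along the cover
  have hσsub : σ ⊆ c.biUnion (fun x₀ => σ.filter (fun x => ‖x - x₀‖ ≤ A * r)) := by
    intro x hx
    obtain ⟨x₀, hx₀, hxx₀⟩ := hcov x hx
    exact Finset.mem_biUnion.2 ⟨x₀, hx₀, Finset.mem_filter.2 ⟨hx, hxx₀⟩⟩
  have hpiece : ∀ x₀ ∈ c, ((σ.filter (fun x => ‖x - x₀‖ ≤ A * r)).card : ℝ) ≤ 3 * M * (A + 1) / η :=
    fun x₀ _ => card_le_of_localDissipation hM hE hη hr hA hRr₀ hRT x₀ _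
      (fun x hx => (Finset.mem_filter.1 hx).2)
      (fun x hx x' hx' hne => hsep x (Finset.mem_filter.1 hx).1 x' (Finset.mem_filter.1 hx').1 hne)
      (fun x hx => hconc x (Finset.mem_filter.1 hx).1)
  calc (σ.card : ℝ) ≤ ((c.biUnion (fun x₀ => σ.filter (fun x => ‖x - x₀‖ ≤ A * r))).card : ℝ) := by
        exact_mod_cast Finset.card_le_card hσsub
    _ ≤ ∑ x₀ ∈ c, ((σ.filter (fun x => ‖x - x₀‖ ≤ A * r)).card : ℝ) := by
        exact_mod_cast Finset.card_biUnion_le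
    _ ≤ ∑ x₀ ∈ c, 3 * M * (A + 1) / η := Finset.sum_le_sum hpiece
    _ = c.card * (3 * M * (A + 1) / η) := by rw [Finset.sum_const, nsmul_eq_mul]

/-! ### 2. The Type-I rate: loud cells are linearly packed -/

variable {ν T : ℝ} {u : ℝ → EuclideanSpace ℝ (Fin 3) → EuclideanSpace ℝ (Fin 3)}
  {p : ℝ → EuclideanSpace ℝ (Fin 3) → ℝ}

/-- **Linear packing along a Type-I blow-up.** For a classical solution on `[0,T)` (`ν > 0`),
Leray–Hopf from a rapidly decaying datum, with the sup-norm Type-I rate at `T`: there are `M, r₀ > 0`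
such that for every `η > 0`, every scale `r > 0` and `A ≥ 0` with `(A+1) r ≤ r₀`, every `2r`-separated
family of `η`-loud centres in a ball `‖x − x₀‖ ≤ A r` has at most `3M(A+1)/η` members. Uniform local
Type I (`uniformLocalTypeI_of_isTypeIBlowup`) + `card_le_of_localDissipation`.
[cite: Seregin2014, Ch. 6 §6.3 Prop. 3.11 (i)] -/
theorem linearPacking_of_isTypeIBlowup (hν : 0 < ν) (hT : 0 < T)
    (hsol : IsClassicalNSSolutionOn (Ico 0 T) ν 0 u p) (hLH : IsLerayHopfOn T ν 0 (u 0) u)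
    (hdec : HasRapidSpatialDecay (u 0)) (hI : IsTypeIBlowup u T) :
    ∃ M r₀ : ℝ, 0 < M ∧ 0 < r₀ ∧ ∀ η : ℝ, 0 < η → ∀ r A : ℝ, 0 < r → 0 ≤ A → (A + 1) * r ≤ r₀ →
      ∀ (x₀ : EuclideanSpace ℝ (Fin 3)) (σ : Finset (EuclideanSpace ℝ (Fin 3))),
        (∀ x ∈ σ, ‖x - x₀‖ ≤ A * r) →
        (∀ x ∈ σ, ∀ x' ∈ σ, x ≠ x' → 2 * r ≤ ‖x - x'‖) →
        (∀ x ∈ σ, ENNReal.ofReal (η * r) ≤ ∫⁻ s in Ioo (T - r ^ 2) T, ∫⁻ y in ball x r,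
          ENNReal.ofReal (frobeniusNormSq (fderiv ℝ (u s) y))) →
        (σ.card : ℝ) ≤ 3 * M * (A + 1) / η := by
  obtain ⟨M, r₁, hM, hr₁, -, hE⟩ :=
    CountQuarterLaw.uniformLocalTypeI_of_isTypeIBlowup hν hT hsol hLH hdec hI
  refine ⟨M, min r₁ (Real.sqrt T), hM, lt_min hr₁ (Real.sqrt_pos.2 hT), ?_⟩
  intro η hη r A hr hA hR x₀ σ hσ hsep hconc
  have hRr₁ : (A + 1) * r ≤ r₁ := hR.trans (min_le_left _ _)
  have hRT : ((A + 1) * r) ^ 2 ≤ T := by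
    have h1 : (A + 1) * r ≤ Real.sqrt T := hR.trans (min_le_right _ _)
    have h0 : 0 ≤ (A + 1) * r := by positivity
    have := pow_le_pow_left₀ h0 h1 2
    rwa [Real.sq_sqrt hT.le] at this
  have hE' : ∀ (x : EuclideanSpace ℝ (Fin 3)), ∀ R ∈ Ioc 0 r₁, R ^ 2 ≤ T →
      ∫⁻ t in Ioo (T - R ^ 2) T, ∫⁻ y in ball x R, ‖fderiv ℝ (u t) y‖ₑ ^ 2 ≤
        ENNReal.ofReal (M * R) :=
    fun x R hR hRT => hE T ⟨hT, le_rfl⟩ x R hR hRT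
  exact card_le_of_localDissipation hM.le hE' hη hr hA hRr₁ hRT x₀ σ hσ hsep hconc

/-! ### 3. The cluster law -/

/-- **Clustered ⟹ counted**, along one Type-I solution: if for every `η > 0` the `η`-loud centres at
scale `r` are covered by at most `k` balls of radius `A r` (`k, A, r₁` depending on `η`, uniformly in
`0 < r ≤ r₁`), then the scale-uniform concentration count (conclusion of
`UniformConcentrationCountTypeI`, stmt-23970) holds for that solution. [folklore] -/
theorem uniformCount_of_clustered (hν : 0 < ν) (hT : 0 < T)
    (hsol : IsClassicalNSSolutionOn (Ico 0 T) ν 0 u p) (hLH : IsLerayHopfOn T ν 0 (u 0) u)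
    (hdec : HasRapidSpatialDecay (u 0)) (hI : IsTypeIBlowup u T)
    (hcl : ∀ η : ℝ, 0 < η → ∃ (k : ℕ) (A r₁ : ℝ), 0 ≤ A ∧ 0 < r₁ ∧ ∀ r : ℝ, 0 < r → r ≤ r₁ →
      ∃ c : Finset (EuclideanSpace ℝ (Fin 3)), c.card ≤ k ∧
        ∀ x : EuclideanSpace ℝ (Fin 3),
          ENNReal.ofReal (η * r) ≤ ∫⁻ s in Ioo (T - r ^ 2) T, ∫⁻ y in ball x r,
            ENNReal.ofReal (frobeniusNormSq (fderiv ℝ (u s) y)) → ∃ x₀ ∈ c, ‖x - x₀‖ ≤ A * r) :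
    ∀ η : ℝ, 0 < η → ∃ N : ℕ, ∃ r₀ : ℝ, 0 < r₀ ∧ ∀ r : ℝ, 0 < r → r ≤ r₀ →
      ∀ σ : Finset (EuclideanSpace ℝ (Fin 3)),
        (∀ x ∈ σ, ∀ x' ∈ σ, x ≠ x' → 2 * r ≤ ‖x - x'‖) →
        (∀ x ∈ σ, ENNReal.ofReal (η * r) ≤ ∫⁻ s in Ioo (T - r ^ 2) T, ∫⁻ y in ball x r,
          ENNReal.ofReal (frobeniusNormSq (fderiv ℝ (u s) y))) → σ.card ≤ N := by
  obtain ⟨M, r₀, hM, hr₀, hpack⟩ := linearPacking_of_isTypeIBlowup hν hT hsol hLH hdec hI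
  intro η hη
  obtain ⟨k, A, r₁, hA, hr₁, hcov⟩ := hcl η hη
  have hA1 : 0 < A + 1 := by linarith
  refine ⟨k * ⌈3 * M * (A + 1) / η⌉₊, min r₁ (r₀ / (A + 1)), lt_min hr₁ (div_pos hr₀ hA1), ?_⟩
  intro r hr hrle σ hsep hconc
  obtain ⟨c, hck, hc⟩ := hcov r hr (hrle.trans (min_le_left _ _))
  have hR : (A + 1) * r ≤ r₀ := by
    have := hrle.trans (min_le_right _ _)
    rw [le_div_iff₀ hA1] at this
    linarith
  have hreal : (σ.card : ℝ) ≤ c.card * (3 * M * (A + 1) / η) := by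
    -- via the Type-I packing applied ball by ball (re-derive the cover bound from `hpack`)
    classical
    have hσsub : σ ⊆ c.biUnion (fun x₀ => σ.filter (fun x => ‖x - x₀‖ ≤ A * r)) := by
      intro x hx
      obtain ⟨x₀, hx₀, hxx₀⟩ := hc x (hconc x hx)
      exact Finset.mem_biUnion.2 ⟨x₀, hx₀, Finset.mem_filter.2 ⟨hx, hxx₀⟩⟩
    have hpiece : ∀ x₀ ∈ c, ((σ.filter (fun x => ‖x - x₀‖ ≤ A * r)).card : ℝ) ≤
        3 * M * (A + 1) / η :=
      fun x₀ _ => hpack η hη r A hr hA hR x₀ _ (fun x hx => (Finset.mem_filter.1 hx).2)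
        (fun x hx x' hx' hne => hsep x (Finset.mem_filter.1 hx).1 x' (Finset.mem_filter.1 hx').1 hne)
        (fun x hx => hconc x (Finset.mem_filter.1 hx).1)
    calc (σ.card : ℝ) ≤ ((c.biUnion (fun x₀ => σ.filter (fun x => ‖x - x₀‖ ≤ A * r))).card : ℝ) := by
          exact_mod_cast Finset.card_le_card hσsub
      _ ≤ ∑ x₀ ∈ c, ((σ.filter (fun x => ‖x - x₀‖ ≤ A * r)).card : ℝ) := by
          exact_mod_cast Finset.card_biUnion_le
      _ ≤ ∑ x₀ ∈ c, 3 * M * (A + 1) / η := Finset.sum_le_sum hpiece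
      _ = c.card * (3 * M * (A + 1) / η) := by rw [Finset.sum_const, nsmul_eq_mul]
  have h2 : (c.card : ℝ) * (3 * M * (A + 1) / η) ≤ (k : ℝ) * (⌈3 * M * (A + 1) / η⌉₊ : ℝ) := by
    have hq0 : 0 ≤ 3 * M * (A + 1) / η := by positivity
    exact mul_le_mul (by exact_mod_cast hck) (Nat.le_ceil _) hq0 (Nat.cast_nonneg _)
  have h3 : (σ.card : ℝ) ≤ ((k * ⌈3 * M * (A + 1) / η⌉₊ : ℕ) : ℝ) := by
    push_cast
    exact hreal.trans h2
  exact_mod_cast h3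

/-- **Clustered ⟹ quarter law**, along one solution: under the hypotheses of K1 (`QuarterLawTypeI`),
if the loud cells are clustered as in `uniformCount_of_clustered`, then `∫‖curl u(t)‖² ≤ K/√(T−t)` on
`[0,T)` — by the landed by-name stub `CountQuarterLaw.stub_countQuarterLaw`. [folklore] -/
theorem quarterLaw_of_clustered (hν : 0 < ν) (hT : 0 < T)
    (hmax : IsMaximalSmoothSolution ν 0 u p T) (hLH : IsLerayHopfOn T ν 0 (u 0) u)
    (hdec : HasRapidSpatialDecay (u 0)) (hI : IsTypeIBlowup u T)
    (hcl : ∀ η : ℝ, 0 < η → ∃ (k : ℕ) (A r₁ : ℝ), 0 ≤ A ∧ 0 < r₁ ∧ ∀ r : ℝ, 0 < r → r ≤ r₁ →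
      ∃ c : Finset (EuclideanSpace ℝ (Fin 3)), c.card ≤ k ∧
        ∀ x : EuclideanSpace ℝ (Fin 3),
          ENNReal.ofReal (η * r) ≤ ∫⁻ s in Ioo (T - r ^ 2) T, ∫⁻ y in ball x r,
            ENNReal.ofReal (frobeniusNormSq (fderiv ℝ (u s) y)) → ∃ x₀ ∈ c, ‖x - x₀‖ ≤ A * r) :
    ∃ K : ℝ, ∀ t ∈ Ico 0 T,
      ∫⁻ x, ‖curl (u t) x‖ₑ ^ 2 ≤ ENNReal.ofReal (K / Real.sqrt (T - t)) :=
  CountQuarterLaw.stub_countQuarterLaw ν T hν hT u p hmax hLH hdec hI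
    (uniformCount_of_clustered hν hT hmax.1 hLH hdec hI hcl)

/-- **Packing ⟹ net** (pure combinatorics): if every `2r`-separated finite subset of `S ⊆ ℝ³` has at
most `N` points, then some `2r`-separated `c ⊆ S` with `#c ≤ N` is a `2r`-net of `S`. [folklore] -/
theorem net_of_separated_card_le {S : Set (EuclideanSpace ℝ (Fin 3))} {r : ℝ} (hr : 0 < r) {N : ℕ}
    (h : ∀ σ : Finset (EuclideanSpace ℝ (Fin 3)), (↑σ : Set (EuclideanSpace ℝ (Fin 3))) ⊆ S →
      (∀ x ∈ σ, ∀ x' ∈ σ, x ≠ x' → 2 * r ≤ ‖x - x'‖) → σ.card ≤ N) :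
    ∃ c : Finset (EuclideanSpace ℝ (Fin 3)), (↑c : Set (EuclideanSpace ℝ (Fin 3))) ⊆ S ∧ c.card ≤ N ∧
      ∀ x ∈ S, ∃ x₀ ∈ c, ‖x - x₀‖ ≤ 2 * r := by
  classical
  set P : ℕ → Prop := fun k => ∃ σ : Finset (EuclideanSpace ℝ (Fin 3)),
    (↑σ : Set (EuclideanSpace ℝ (Fin 3))) ⊆ S ∧
      (∀ x ∈ σ, ∀ x' ∈ σ, x ≠ x' → 2 * r ≤ ‖x - x'‖) ∧ σ.card = k with hP_def
  have hP0 : P 0 := ⟨∅, by simp, by simp, rfl⟩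
  set m : ℕ := Nat.findGreatest P N with hm_def
  obtain ⟨σ, hσS, hσsep, hσcard⟩ : P m := Nat.findGreatest_spec (Nat.zero_le N) hP0
  have hmN : m ≤ N := Nat.findGreatest_le N
  refine ⟨σ, hσS, hσcard ▸ hmN, fun y hy => ?_⟩
  by_contra hfar
  push Not at hfar
  -- `hfar : ∀ x₀ ∈ σ, 2 * r < ‖y - x₀‖`
  have hyσ : y ∉ σ := fun hyσ => by
    have := hfar y hyσ
    rw [sub_self, norm_zero] at this
    linarith
  have hP' : P (m + 1) := by
    refine ⟨insert y σ, ?_, ?_, by rw [Finset.card_insert_of_notMem hyσ, hσcard]⟩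
    · rw [Finset.coe_insert]
      exact insert_subset hy hσS
    · intro x hx x' hx' hne
      rw [Finset.mem_insert] at hx hx'
      rcases hx with rfl | hx
      · rcases hx' with rfl | hx'
        · exact absurd rfl hne
        · exact (hfar x' hx').le
      · rcases hx' with rfl | hx'
        · rw [norm_sub_rev]; exact (hfar x hx).le
        · exact hσsep x hx x' hx' hne
  obtain ⟨σ', hσ'S, hσ'sep, hσ'card⟩ := hP'
  have hle : m + 1 ≤ N := hσ'card ▸ h σ' hσ'S hσ'sep
  exact Nat.findGreatest_is_greatest (Nat.lt_succ_self m) hle ⟨σ', hσ'S, hσ'sep, hσ'card⟩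

/-- **Counted ⟹ clustered** (pure combinatorics, one scale): if every `2r`-separated family of `η`-loud
centres at scale `r` has at most `N` members, the `η`-loud centres are covered by at most `N` balls of
radius `2r`. [folklore] -/
theorem clustered_of_count {r η : ℝ} (hr : 0 < r) {N : ℕ}
    (hN : ∀ σ : Finset (EuclideanSpace ℝ (Fin 3)),
      (∀ x ∈ σ, ∀ x' ∈ σ, x ≠ x' → 2 * r ≤ ‖x - x'‖) →
      (∀ x ∈ σ, ENNReal.ofReal (η * r) ≤ ∫⁻ s in Ioo (T - r ^ 2) T, ∫⁻ y in ball x r,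
        ENNReal.ofReal (frobeniusNormSq (fderiv ℝ (u s) y))) → σ.card ≤ N) :
    ∃ c : Finset (EuclideanSpace ℝ (Fin 3)), c.card ≤ N ∧
      ∀ x : EuclideanSpace ℝ (Fin 3),
        ENNReal.ofReal (η * r) ≤ ∫⁻ s in Ioo (T - r ^ 2) T, ∫⁻ y in ball x r,
          ENNReal.ofReal (frobeniusNormSq (fderiv ℝ (u s) y)) → ∃ x₀ ∈ c, ‖x - x₀‖ ≤ 2 * r := by
  set S : Set (EuclideanSpace ℝ (Fin 3)) := {x | ENNReal.ofReal (η * r) ≤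
    ∫⁻ s in Ioo (T - r ^ 2) T, ∫⁻ y in ball x r, ENNReal.ofReal (frobeniusNormSq (fderiv ℝ (u s) y))}
    with hS
  obtain ⟨c, -, hcN, hnet⟩ := net_of_separated_card_le (S := S) hr (N := N)
    (fun σ hσS hsep => hN σ hsep fun x hx => by
      have hx' : x ∈ S := hσS (Finset.mem_coe.2 hx)
      simpa only [hS, mem_setOf_eq] using hx')
  exact ⟨c, hcN, fun x hx => hnet x (by simpa only [hS, mem_setOf_eq] using hx)⟩

end QuarterLawLinearPacking

end Summit.NavierStokesRegularity.NavierStokesRegularity.Theorems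

end
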